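import Summits.Ventures.CertifiedManyBodySolver.Observables.SourcedGibbsTrialCapRows
import Summits.Ventures.CertifiedManyBodySolver.Observables.PinningFieldMenuReaders
import HarnessLib

/-!
# Pinning-field response FLOOR at the off-anchor point `(U, μ, t′) = (2, 1/2, 0)`, field `h = √2/7`:
# the B′1 LITERAL CONSUMER in hypothesis form (cell `hubbard-cq`, CQ-TABLE §B′1, W4 leg)

HONEST FRAMING: zero compute; glue only; NO number is claimed in this file. Every statement takes the two
certified rows as NAMED hypotheses — `hlo`, a source-FREE grand-canonical energy FLOOR
`lo·L² ≤ E₀(dWaveSourceTorus L 2 (1/2) 0)` (the shape a gauge-invariant window certificate proves on every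
torus into which its window fits: `dWaveSourceTorus_groundEnergy_ge_of_window_certificate[_d4][_eventually]`,
read as the cell `SourcedTorusEnergyLowerRow L 0 2 (1/2) 0 lo` by `SourcedTorusEnergyLowerRow.of_tp0`;
producer: hubbard-cq-pilot-1's job GU2 = kit j260099), and `hcap`, a SOURCED energy CEILING
`E₀(dWaveSourceTorus L 2 (1/2) (√2/7)) ≤ φ·L²` AT the field (the Hartree–Fock–BCS pinned Gibbs trial state:
`groundEnergy_dWaveSourceTorus_le_HFBCS` + a certified evaluation of its one-body functional, read as the cell
`SourcedTorusEnergyUpperRow L 0 2 (1/2) (√2/7) φ` by `sourcedTorusEnergyUpperRow_of_HFBCS`; producer: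
hubbard-obs-pin-2's HFBCS-CAP-CERT.md, kit j259362: `φ_L(1/2) ≤ −1.8626759` at `L = 256`, 13 sides
`L ∈ {8, …, 256}`, each exact at its own `L`) — and returns the finite-torus RESPONSE FLOOR
`m_L(√2/7) ≥ (lo − φ)/(2·√2/7) = (lo − φ)·7√2/4` on the tracial sourced `d`-wave pair density
`m_L = dWaveSourceDensity L 2 (1/2) (√2/7)` (tree units: `Re ω₀(Δ_d)/L²`, HALF of Koma–Tasaki's `m`), by the
left Hellmann–Feynman chord of the concave sourced energy (`PinningFieldChords` §2,
`SourcedGibbsTrialCapRows.dWaveSourceDensity_ge_of_rows`, `SourcedOrderParameterFloor`). The torus side `L`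
and the slots `lo`, `φ` stay SYMBOLIC, so the row clicks by name the hour both certificates are filed, at
any common `L`.

Because the field is IRRATIONAL (`h = √2/7`, `h² = 2/49`, the cell's `h_tree ≈ 0.202`), §0 supplies the
RATIONAL reading rule the literal needs: a rational slot `m` is admissible (`m·2h ≤ lo − φ`) as soon as
`0 ≤ lo − φ` and `8·m² ≤ 49·(lo − φ)²` — decidable by `norm_num` on the filed rationals — and the quotable
decimal form `m_L ≥ 2.474872·(lo − φ)` (`7√2/4 = 2.4748737…`). §1 is the one-torus consumer (Rows-cell
hypotheses, raw ground-energy hypotheses, rational slot ⇒ `PinFieldTorusResponseFloor`); §2 the uniform-in-`L`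
forms (`SourcedEnergyLowerRow`/`UpperRow` ⇒ `PinFieldResponseFloorAt`, and the stair
`m ≤ liminf_L m_{L+1}(√2/7)` from all-sides rows or from threshold rows) — the uniform cap needs the
Brillouin-zone Riemann-sum remainder for the free pinned torus (hubbard-cq-p2's lemma) or a per-`L` table;
until then §1 is the reading of record, per `L`.

What this is NOT: not a statement at `U = 8`; not order of the source-free model (a finite-`h` response is
symmetry-allowed, hubbard-cq WORDING W1 «finite-h response (certified)»); not a phase word; not a
superconductivity verdict. Honesty node (`PinningFieldChords.floorSlot_nonpos_of_transported_cap`): the cap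
MUST be a cap of the SOURCED problem at `h` — the HF–BCS pinned state is one; a cap inherited from `h = 0`
would admit only `m ≤ 0`. No definition, no named fact, no `sorry`.

Cell `hubbard-cq` (D-0082 (c) / D-0085), seat `hubbard-cq-p1` (`prover-hubbard-cq-p1-g2-0`), lead ASSIGN
2026-08-26T20:32:30Z. References: T. Koma, H. Tasaki, J. Stat. Phys. 76 (1994) 745, §1 [KomaTasaki1994];
R. B. Griffiths, Phys. Rev. 152 (1966) 240, §II [Griffiths1966]; V. Bach, E. H. Lieb, J. P. Solovej,
J. Stat. Phys. 76 (1994) 3, §2 [BachLiebSolovej1994].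
-/

noncomputable section

namespace Summit.Ventures.CertifiedManyBodySolver.Observables

open Matrix Literature.MathematicalPhysics.QuantumLattice Literature.Probability.LatticeModels
open Filter Topology
open scoped ComplexOrder

open Summit.Ventures.CertifiedManyBodySolver

/-! ### §0 Arithmetic of the irrational field step `2·(√2/7)` -/

section Arithmetic

/-- The B′1 field `h = √2/7` is positive (so `0 < h` is the chord's `h₁ < h` with `h₁ = 0`). [folklore] -/
theorem sqrt_two_div_seven_pos : (0 : ℝ) < Real.sqrt 2 / 7 := by positivity

/-- Spelling conversion: `√2·(1/7) = √2/7` (the `h = g·√2`, `g = 1/7` convention of the kill kits). [folklore] -/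
theorem sqrt_two_mul_one_div_seven : Real.sqrt 2 * (1 / 7) = Real.sqrt 2 / 7 := by ring

/-- Spelling conversion: `√(2/49) = √2/7` (`h² = 2/49`). [folklore] -/
theorem sqrt_two_div_fortyNine : Real.sqrt (2 / 49) = Real.sqrt 2 / 7 := by
  rw [Real.sqrt_div' 2 (by norm_num : (0 : ℝ) ≤ 49)]
  have h49 : Real.sqrt 49 = 7 := by
    rw [show (49 : ℝ) = 7 ^ 2 by norm_num, Real.sqrt_sq (by norm_num : (0 : ℝ) ≤ 7)]
  rw [h49]

/-- The chord's denominator inverted: `s/(2·√2/7) = s·(7√2/4)`. [folklore] -/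
theorem div_two_mul_sqrt_two_div_seven (s : ℝ) :
    s / (2 * (Real.sqrt 2 / 7)) = s * (7 * Real.sqrt 2 / 4) := by
  have h2 : Real.sqrt 2 ^ 2 = 2 := Real.sq_sqrt (by norm_num)
  have hpos : (0 : ℝ) < Real.sqrt 2 := Real.sqrt_pos.2 (by norm_num)
  rw [div_eq_iff (by positivity)]
  have e : s * (7 * Real.sqrt 2 / 4) * (2 * (Real.sqrt 2 / 7)) = s * Real.sqrt 2 ^ 2 / 2 := by ring
  rw [e, h2]; ring

/-- Quotable decimal: `2.474872 < 7√2/4` (`= 2.4748737…`). [folklore] -/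
theorem seven_mul_sqrt_two_div_four_gt : (2474872 / 10 ^ 6 : ℝ) < 7 * Real.sqrt 2 / 4 := by
  have h : (1414213 / 10 ^ 6 : ℝ) < Real.sqrt 2 := by
    rw [Real.lt_sqrt (by norm_num)]
    norm_num
  linarith

/-- **RATIONAL READING RULE for the irrational field.** For rational `m` and slack `s ≥ 0` with
`8·m² ≤ 49·s²` (decidable by `norm_num`), `m·(2·(√2/7 − 0)) ≤ s` — the side condition `hm` of the
floor chord `PinFieldTorusResponseFloor.of_energyRows` at `(h₁, h) = (0, √2/7)`. (Either sign of `m`: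
a negative `m` is admissible trivially.) [folklore] -/
theorem ratCast_mul_two_sqrt_two_div_seven_le {m s : ℚ} (hs : 0 ≤ s) (hms : 8 * m ^ 2 ≤ 49 * s ^ 2) :
    ((m : ℚ) : ℝ) * (2 * (Real.sqrt 2 / 7 - 0)) ≤ ((s : ℚ) : ℝ) := by
  have h2 : Real.sqrt 2 ^ 2 = 2 := Real.sq_sqrt (by norm_num)
  have hx : (((m : ℚ) : ℝ) * (2 * (Real.sqrt 2 / 7 - 0))) ^ 2 = ((m : ℚ) : ℝ) ^ 2 * 8 / 49 := by
    have e : (((m : ℚ) : ℝ) * (2 * (Real.sqrt 2 / 7 - 0))) ^ 2 =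
        ((m : ℚ) : ℝ) ^ 2 * Real.sqrt 2 ^ 2 * 4 / 49 := by ring
    rw [e, h2]; ring
  have hms' : ((m : ℚ) : ℝ) ^ 2 * 8 / 49 ≤ ((s : ℚ) : ℝ) ^ 2 := by
    have h' : (8 : ℝ) * ((m : ℚ) : ℝ) ^ 2 ≤ 49 * ((s : ℚ) : ℝ) ^ 2 := by exact_mod_cast hms
    linarith
  have hs' : (0 : ℝ) ≤ ((s : ℚ) : ℝ) := by exact_mod_cast hs
  have habs := abs_le_of_sq_le_sq (by rw [hx]; exact hms') hs'
  exact (le_abs_self _).trans habs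

end Arithmetic

/-! ### §1 One torus, `L` symbolic: the B′1 literal floor from the two named rows -/

section OneTorus

variable (L : ℕ) [NeZero L]

/-- **B′1 LITERAL FLOOR, Rows-cell form.** At `(U, μ, t′) = (2, 1/2, 0)`: a source-free energy FLOOR cell
`hlo : SourcedTorusEnergyLowerRow L 0 2 (1/2) 0 lo` (`lo·L² ≤ E₀(A_L(0))`) and a SOURCED energy CEILING cell
`hcap : SourcedTorusEnergyUpperRow L 0 2 (1/2) (√2/7) φ` (`E₀(A_L(√2/7)) ≤ φ·L²`, the HF–BCS cap via
`sourcedTorusEnergyUpperRow_of_HFBCS`) give `(lo − φ)/(2·√2/7) ≤ m_L(√2/7) = dWaveSourceDensity L 2 (1/2) (√2/7)`.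
Teeth iff `φ < lo`. [cite: KomaTasaki1994, §1] [cite: Griffiths1966, §II] -/
theorem dWaveSourceDensity_U2_ge_of_rows {lo φ : ℚ} (hlo : SourcedTorusEnergyLowerRow L 0 2 (1 / 2) 0 lo)
    (hcap : SourcedTorusEnergyUpperRow L 0 2 (1 / 2) (Real.sqrt 2 / 7) φ) :
    (((lo : ℚ) : ℝ) - ((φ : ℚ) : ℝ)) / (2 * (Real.sqrt 2 / 7)) ≤ dWaveSourceDensity L 2 (1 / 2) (Real.sqrt 2 / 7) := by
  have h := dWaveSourceDensity_ge_of_rows L 2 (1 / 2) sqrt_two_div_seven_pos hlo hcap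
  rwa [sub_zero] at h

/-- **B′1 literal floor, product form**: `(lo − φ)·(7√2/4) ≤ m_L(√2/7)`. [cite: KomaTasaki1994, §1] -/
theorem dWaveSourceDensity_U2_ge_mul_of_rows {lo φ : ℚ} (hlo : SourcedTorusEnergyLowerRow L 0 2 (1 / 2) 0 lo)
    (hcap : SourcedTorusEnergyUpperRow L 0 2 (1 / 2) (Real.sqrt 2 / 7) φ) :
    (((lo : ℚ) : ℝ) - ((φ : ℚ) : ℝ)) * (7 * Real.sqrt 2 / 4) ≤ dWaveSourceDensity L 2 (1 / 2) (Real.sqrt 2 / 7) := by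
  rw [← div_two_mul_sqrt_two_div_seven]
  exact dWaveSourceDensity_U2_ge_of_rows L hlo hcap

/-- **B′1 literal floor, quotable decimal form**: if `φ ≤ lo` then `2.474872·(lo − φ) ≤ m_L(√2/7)`.
[cite: KomaTasaki1994, §1] -/
theorem dWaveSourceDensity_U2_ge_decimal_of_rows {lo φ : ℚ} (hlo : SourcedTorusEnergyLowerRow L 0 2 (1 / 2) 0 lo)
    (hcap : SourcedTorusEnergyUpperRow L 0 2 (1 / 2) (Real.sqrt 2 / 7) φ) (hle : φ ≤ lo) :
    (2474872 / 10 ^ 6 : ℝ) * (((lo : ℚ) : ℝ) - ((φ : ℚ) : ℝ)) ≤ dWaveSourceDensity L 2 (1 / 2) (Real.sqrt 2 / 7) := by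
  have hs : (0 : ℝ) ≤ ((lo : ℚ) : ℝ) - ((φ : ℚ) : ℝ) := by
    have : ((φ : ℚ) : ℝ) ≤ ((lo : ℚ) : ℝ) := by exact_mod_cast hle
    linarith
  have h1 := dWaveSourceDensity_U2_ge_mul_of_rows L hlo hcap
  have h2 : (2474872 / 10 ^ 6 : ℝ) * (((lo : ℚ) : ℝ) - ((φ : ℚ) : ℝ)) ≤
      (((lo : ℚ) : ℝ) - ((φ : ℚ) : ℝ)) * (7 * Real.sqrt 2 / 4) := by
    rw [mul_comm]
    exact mul_le_mul_of_nonneg_left seven_mul_sqrt_two_div_four_gt.le hs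
  exact h2.trans h1

/-- **B′1 literal floor, RAW ground-energy form** (real slots; the hypotheses are VERBATIM the conclusion
shapes of the producers' theorems: `hlo` of `dWaveSourceTorus_groundEnergy_ge_of_window_certificate[_d4]`
at `(U, μ, h) = (2, 1/2, 0)`, `hcap` of `groundEnergy_dWaveSourceTorus_le_HFBCS L 2 (1/2) μ′ (√2/7) β` chained
with the certified bound on its one-body functional): `(lo − φ)/(2·√2/7) ≤ m_L(√2/7)`.
[cite: KomaTasaki1994, §1] [cite: Griffiths1966, §II] -/
theorem dWaveSourceDensity_U2_ge_of_groundEnergy_bounds {lo φ : ℝ}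
    (hlo : lo * (L : ℝ) ^ 2 ≤ (dWaveSourceTorus L 2 (1 / 2) 0).groundEnergy)
    (hcap : (dWaveSourceTorus L 2 (1 / 2) (Real.sqrt 2 / 7)).groundEnergy ≤ φ * (L : ℝ) ^ 2) :
    (lo - φ) / (2 * (Real.sqrt 2 / 7)) ≤ dWaveSourceDensity L 2 (1 / 2) (Real.sqrt 2 / 7) := by
  have h := dWaveSourceDensity_ge_of_energy_window L 2 (1 / 2) sqrt_two_div_seven_pos hlo hcap
  rwa [sub_zero] at h

/-- Raw form ⇒ Rows cells: the two raw bounds with RATIONAL slots are exactly the cells `hlo`/`hcap` of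
`dWaveSourceDensity_U2_ge_of_rows` (instance-independent restatement; the Rows file's local
`DecidableEq (FermionTorus 2 L)` agrees with the library one by `Subsingleton.elim`). [folklore] -/
theorem sourcedTorusEnergyRows_U2_of_groundEnergy_bounds {lo φ : ℚ}
    (hlo : ((lo : ℚ) : ℝ) * (L : ℝ) ^ 2 ≤ (dWaveSourceTorus L 2 (1 / 2) 0).groundEnergy)
    (hcap : (dWaveSourceTorus L 2 (1 / 2) (Real.sqrt 2 / 7)).groundEnergy ≤ ((φ : ℚ) : ℝ) * (L : ℝ) ^ 2) :
    SourcedTorusEnergyLowerRow L 0 2 (1 / 2) 0 lo ∧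
      SourcedTorusEnergyUpperRow L 0 2 (1 / 2) (Real.sqrt 2 / 7) φ := by
  refine ⟨SourcedTorusEnergyLowerRow.of_tp0 le_rfl (by convert hlo using 2), ?_⟩
  rw [sourcedTorusEnergyUpperRow_iff, dWaveSourceTorusTT'_zero_tp]
  convert hcap using 2

/-- **B′1 literal floor as a response CELL with a RATIONAL slot**: `PinFieldTorusResponseFloor L 0 2 (1/2) (√2/7) m`
(`m ≤ m_L(√2/7)`) for every rational `m` with `0 ≤ lo − φ` and `8·m² ≤ 49·(lo − φ)²` — both side conditions
decidable by `norm_num` on the filed rationals (the field is irrational, so the chord condition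
`m·2h ≤ lo − φ` is read through its square). TEMPLATE for the W4 row:
`pinFieldTorusResponseFloor_U2_of_rows L hlo hcap (by norm_num) (by norm_num)`.
[cite: KomaTasaki1994, §1] [cite: Griffiths1966, §II] -/
theorem pinFieldTorusResponseFloor_U2_of_rows {lo φ m : ℚ}
    (hlo : SourcedTorusEnergyLowerRow L 0 2 (1 / 2) 0 lo)
    (hcap : SourcedTorusEnergyUpperRow L 0 2 (1 / 2) (Real.sqrt 2 / 7) φ)
    (hs : 0 ≤ lo - φ) (hm : 8 * m ^ 2 ≤ 49 * (lo - φ) ^ 2) :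
    PinFieldTorusResponseFloor L 0 2 (1 / 2) (Real.sqrt 2 / 7) m := by
  refine PinFieldTorusResponseFloor.of_energyRows sqrt_two_div_seven_pos hlo hcap ?_
  have h := ratCast_mul_two_sqrt_two_div_seven_le hs hm
  push_cast at h
  exact h

/-- The response cell read back in tree units: `PinFieldTorusResponseFloor L 0 2 (1/2) (√2/7) m` IS
`m ≤ dWaveSourceDensity L 2 (1/2) (√2/7)`. [cite: KomaTasaki1994, §1] -/
theorem pinFieldTorusResponseFloor_U2_iff {m : ℚ} :
    PinFieldTorusResponseFloor L 0 2 (1 / 2) (Real.sqrt 2 / 7) m ↔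
      ((m : ℚ) : ℝ) ≤ dWaveSourceDensity L 2 (1 / 2) (Real.sqrt 2 / 7) := by
  unfold PinFieldTorusResponseFloor
  rw [dWaveSourceDensityTT'_zero]

end OneTorus

/-! ### §2 Uniform in `L`: row progressions ⇒ the floor leaf and the stair -/

section Uniform

variable {q L₀ L₁ : ℕ}

/-- **B′1 literal floor LEAF** (every side `L ≥ max L₀ L₁` with `q ∣ L`): uniform rows
`hlo : SourcedEnergyLowerRow 0 2 (1/2) 0 q L₀ lo` and `hcap : SourcedEnergyUpperRow 0 2 (1/2) (√2/7) q L₁ φ` and a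
rational slot `m` with `0 ≤ lo − φ`, `8·m² ≤ 49·(lo − φ)²` give `PinFieldResponseFloorAt 0 2 (1/2) (√2/7) q (max L₀ L₁) m`.
(The uniform CAP needs a per-`L` table packaged as a row or the Brillouin-zone Riemann-sum remainder of the free
pinned torus; the uniform FLOOR is the native shape of a window certificate, `q = 1`.)
[cite: KomaTasaki1994, §1] [cite: Griffiths1966, §II] -/
theorem pinFieldResponseFloorAt_U2_of_rows {lo φ m : ℚ}
    (hlo : SourcedEnergyLowerRow 0 2 (1 / 2) 0 q L₀ lo)
    (hcap : SourcedEnergyUpperRow 0 2 (1 / 2) (Real.sqrt 2 / 7) q L₁ φ)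
    (hs : 0 ≤ lo - φ) (hm : 8 * m ^ 2 ≤ 49 * (lo - φ) ^ 2) :
    PinFieldResponseFloorAt 0 2 (1 / 2) (Real.sqrt 2 / 7) q (max L₀ L₁) m := by
  refine PinFieldResponseFloorAt.of_energyRows sqrt_two_div_seven_pos hlo hcap ?_
  have h := ratCast_mul_two_sqrt_two_div_seven_le hs hm
  push_cast at h
  exact h

/-- **B′1 literal STAIR floor** (all sides, `q = 1`): the same rows on every large side give
`m ≤ liminf_L m_{L+1}(√2/7)` for the tracial stair of `dWaveSourceDensity · 2 (1/2) (√2/7)` — the one-stair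
object at `h = √2/7` (a finite-`h` response floor in the thermodynamic limit; NOT the order parameter, which is
an infimum over all `h > 0`). [cite: KomaTasaki1994, §1] -/
theorem le_liminf_dWaveSourceDensity_U2_of_rows {lo φ m : ℚ}
    (hlo : SourcedEnergyLowerRow 0 2 (1 / 2) 0 1 L₀ lo)
    (hcap : SourcedEnergyUpperRow 0 2 (1 / 2) (Real.sqrt 2 / 7) 1 L₁ φ)
    (hs : 0 ≤ lo - φ) (hm : 8 * m ^ 2 ≤ 49 * (lo - φ) ^ 2) :
    ((m : ℚ) : ℝ) ≤ liminf (fun L : ℕ => dWaveSourceDensity (L + 1) 2 (1 / 2) (Real.sqrt 2 / 7)) atTop := by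
  have h := (pinFieldResponseFloorAt_U2_of_rows hlo hcap hs hm).le_liminf
  simp only [dWaveSourceDensityTT'_zero] at h
  exact h

/-- **B′1 literal stair floor, THRESHOLD form with real slots** (the delivered shapes: a window-certificate
floor `∀ L ≥ L₀, lo·L² ≤ E₀(A_L(0))` and a cap `∀ L ≥ L₁, E₀(A_L(√2/7)) ≤ φ·L²`):
`(lo − φ)/(2·√2/7) ≤ liminf_L m_{L+1}(√2/7)`. [cite: KomaTasaki1994, §1] -/
theorem le_liminf_dWaveSourceDensity_U2_of_thresholds {lo φ : ℝ}
    (hlo : ∀ L : ℕ, L₀ ≤ L → ∀ [NeZero L], lo * (L : ℝ) ^ 2 ≤ (dWaveSourceTorus L 2 (1 / 2) 0).groundEnergy)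
    (hcap : ∀ L : ℕ, L₁ ≤ L → ∀ [NeZero L],
      (dWaveSourceTorus L 2 (1 / 2) (Real.sqrt 2 / 7)).groundEnergy ≤ φ * (L : ℝ) ^ 2) :
    (lo - φ) / (2 * (Real.sqrt 2 / 7)) ≤
      liminf (fun L : ℕ => dWaveSourceDensity (L + 1) 2 (1 / 2) (Real.sqrt 2 / 7)) atTop := by
  have h := le_liminf_dWaveSourceDensity_of_thresholds 2 (1 / 2) sqrt_two_div_seven_pos hlo hcap
  rwa [sub_zero] at h

end Uniform

end Summit.Ventures.CertifiedManyBodySolver.Observables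

end
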